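import Literature.NumberTheory.LFunctions.DirichletExplicitRegionComplexPoints
import Literature.NumberTheory.LFunctions.DirichletExplicitRegionZetaTerm
import HarnessLib

/-!
# McCurley's explicit region: zeros of small height for characters of order 2, 3, 4 (§6), PROVED

Topic `Literature/NumberTheory/LFunctions` (namespace `Literature.NumberTheory.LFunctions.McCurleyStechkin`,
with two lemmas in `DirichletTheta`), continuing `DirichletExplicitRegionComplexPoints.lean` (McCurley §3
at complex points), `DirichletExplicitRegionZetaTerm.lean` (Lemma 3 sharpened) and
`DirichletExplicitRegionRealZeros.lean` (the real-zero clause of Theorem 1). Everything here is PROVED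
(standard axioms); no definitions, NO named fact.

Source: K. S. McCurley, *Explicit zero-free regions for Dirichlet L-functions*, J. Number Theory
**19** (1984) 7–32 [McCurley1984ZFR], Lemma 10 (p. 20) and **§6 "Proof of Theorem 1, the case
|γ| small"** (pp. 29–30): for a primitive character `χ` mod `k` of order `2`, `3` or `4` and a zero
`ρ = β + iγ` of `L(s, χ)` with `|γ| log M ≤ 0.538`, `0.403`, `0.262` respectively
(`M = max{k, k|γ|, 10}`), `β < 1 − 1/(R log M)`, `R = 9.645908801`. The method (Gronwall,
Metsänkylä, with Stechkin's device): a non-negative trigonometric polynomial at the REAL point `σ`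
(`1 + cos θ`; (43) `5 + 8cos θ + 4cos 2θ + cos 3θ = (1 + cos θ)(1 + 2cos θ)²`, which for a cubic
character reads `f(0,χ₀) + f(0,χ) + f(0,χ̄) ≥ 0`; for a quartic character
`f(0,χ₀) + [f(0,χ) + f(0,χ̄)] + f(0,χ²) ≥ 0`), Lemma 3 for `f(0, χ₀)`, and Lemma 10: the explicit
formula (13) at `t = 0` with the complex pair `ρ, 1 − ρ̄` kept,
`f(0,χ) + f(0,χ̄) ≤ 2K log k − 2(σ−β)/((σ−β)² + γ²) − 0.25418` (`|γ| < ½ < β`), then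
`σ = 1 + r/log M` (`r = 0.69, 0.69, 0.62`) and "the left side of (46) is decreasing in `b` and `c`,
and … it follows that `b > 0.104 > 1/R`".

## Main results (all for `χ` primitive mod `k`, `L ≥ log k`, `L ≥ log 10`, a zero `ρ` of `L(s,χ)`)

* `order_two_small_height`: `χ² = χ₀`, `χ ≠ χ₀`, `Im ρ ≠ 0`, `|Im ρ|·L ≤ 0.538` ⇒ `Re ρ < 1 − 1/(R L)`.
* `order_three_small_height`: `χ³ = χ₀`, `χ ≠ χ₀`, `|Im ρ|·L ≤ 0.403` ⇒ `Re ρ < 1 − 1/(R L)`.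
* `order_four_small_height`: `χ⁴ = χ₀`, `χ² ≠ χ₀`, `|Im ρ|·L ≤ 0.262` ⇒ `Re ρ < 1 − 1/(R L)`.
With `L = log M`, `M = max(k, k|γ|, 10)`, these are the three clauses of §6 (for `χ² = χ₀` and
`γ = 0` see `mccurley1984_theorem1_realZeros`).

Supporting results: `lemma10_pair_ge` (McCurley's (21)–(22): the kept pair at `t = 0` is at least
`(σ−β)/((σ−β)²+γ²) − 0.33`), `lemma10_complex`, `lemma10_real` (Lemma 10 per character, our Gamma
constant `0.44` for McCurley's `0.45699`), `DirichletTheta.fAt_le_of_two_zeros` ((13) with two pairs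
kept), `positivity_poly` (positivity at a real point for any polynomial `c₀ + c₁Re χ + c₂Re χ²`
non-negative on the values of `χ`), `re_poly_nonneg_of_cube_eq_one` / `_of_fourth_eq_one`,
`sum_max_gPen_le` (`Σ_{p∣k} max(G(p,σ),0) ≤ 1.07`, the imprimitive penalty of `χ²`, McCurley's
Lemma 9 `1.1257/2`), `endgame_pair` (the optimisation in `r, b, c`).
Our constants (Lemma 3: `0.73` for `0.7833`; Gamma: `0.44`; Lemma 10: `0.33`; penalty `1.07`) leave
the three final margins at `≈ 10⁻³`, exactly as in print (`b > 0.104 > 1/R = 0.10367`).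

## References

* K. S. McCurley, J. Number Theory 19 (1984) 7–32, doi:10.1016/0022-314x(84)90089-1: Lemma 9
  (p. 19), Lemma 10 with (21)–(22) (pp. 20–21), §5 (43) (p. 28), §6 (46)–(47) (pp. 29–30). [McCurley1984ZFR]
* T. Metsänkylä, *Zero-free regions of Dirichlet's L-functions near the point 1*, Ann. Univ. Turku.
  139 (1970) (the method of §6). [Metsankyla1970]
-/

noncomputable section

open Real Complex
open scoped ComplexConjugate

namespace Literature.NumberTheory.LFunctions

/-! ## (13) at a point with two pairs of zeros kept -/

namespace DirichletTheta

open McCurleyStechkin ExplicitPsiChar Literature.Analysis.Complex Literature.Analysis.Complex.HadamardGenusZero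

variable {q : ℕ} [NeZero q] {χ : DirichletCharacter ℂ q}

/-- **(13) with two pairs kept.** For `χ` primitive, `χ ≠ 1`, `σ ≥ 1`, real `t`, and two zeros
`ρ₁, ρ₂` of `L(s, χ)` (`Re ρᵢ > 0`, `Re ρᵢ ≠ ½`) with `ρ₁ ≠ ρ₂`, `ρ₁ ≠ 1 − ρ̄₂`:
`f(t, χ) ≤ K log q + Γ-terms − [F(s,ρ₁) − κF(s₁,ρ₁)] − [F(s,ρ₂) − κF(s₁,ρ₂)]`.
[cite: McCurley1984ZFR, Lemma 10 (proof) and (13)] -/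
theorem fAt_le_of_two_zeros (hχ : χ.IsPrimitive) (h1 : χ ≠ 1) {σ : ℝ} (hσ : 1 ≤ σ) (t : ℝ)
    {ρ₁ ρ₂ : ℂ} (hz₁ : χ.LFunction ρ₁ = 0) (h0₁ : 0 < ρ₁.re) (hhalf₁ : ρ₁.re ≠ 1 / 2)
    (hz₂ : χ.LFunction ρ₂ = 0) (h0₂ : 0 < ρ₂.re) (hhalf₂ : ρ₂.re ≠ 1 / 2)
    (hne : ρ₁ ≠ ρ₂) (hne' : ρ₁ ≠ 1 - conj ρ₂) :
    fAt χ σ t ≤ bigK * Real.log q + gammaDiff (charParity χ) σ t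
      - (stF (σ + t * I) ρ₁ - kappa * stF (sigmaOne σ + t * I) ρ₁)
      - (stF (σ + t * I) ρ₂ - kappa * stF (sigmaOne σ + t * I) ρ₂) := by
  classical
  have hd := differentiable_dirichletXi h1
  have hξ0 := dirichletXi_zero_ne_zero hχ h1
  have hlt : ∀ {ρ : ℂ}, χ.LFunction ρ = 0 → ρ.re < 1 := fun {ρ} hz ↦ by
    by_contra h
    exact DirichletCharacter.LFunction_ne_zero_of_one_le_re χ (Or.inl h1) (not_lt.1 h) hz
  have hξρ : ∀ {ρ : ℂ}, χ.LFunction ρ = 0 → 0 < ρ.re → dirichletXi χ ρ = 0 := fun hz h0 ↦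
    (dirichletXi_eq_zero_iff_mem_charNontrivialZeros hχ h1 _).2 ⟨hz, h0, hlt hz⟩
  have hpos : ∀ {ρ : ℂ}, dirichletXi χ ρ = 0 → 0 < analyticOrderNatAt (dirichletXi χ) ρ := fun h ↦
    Nat.pos_of_ne_zero ((analyticOrderNatAt_ne_zero_iff hd hξ0 _).2 h)
  set i₁ : ZIdx (dirichletXi χ) := ⟨(ρ₁, 0), hξρ hz₁ h0₁, hpos (hξρ hz₁ h0₁)⟩ with hi₁
  set i₂ : ZIdx (dirichletXi χ) := ⟨(ρ₂, 0), hξρ hz₂ h0₂, hpos (hξρ hz₂ h0₂)⟩ with hi₂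
  set j₁ := zerosRefl hχ h1 i₁ with hj₁
  set j₂ := zerosRefl hχ h1 i₂ with hj₂
  have p₁ : i₁.pt = ρ₁ := rfl
  have p₂ : i₂.pt = ρ₂ := rfl
  have q₁ : j₁.pt = 1 - conj ρ₁ := by rw [hj₁, zerosRefl_pt, p₁]
  have q₂ : j₂.pt = 1 - conj ρ₂ := by rw [hj₂, zerosRefl_pt, p₂]
  have ne_of_pt : ∀ {a b : ZIdx (dirichletXi χ)}, a.pt ≠ b.pt → a ≠ b := fun h hab ↦ h (hab ▸ rfl)
  have hself : ∀ {ρ : ℂ}, ρ.re ≠ 1 / 2 → ρ ≠ 1 - conj ρ := fun {ρ} hh h ↦ by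
    have h' := congrArg Complex.re h
    simp only [sub_re, one_re, conj_re] at h'
    apply hh; linarith
  have n11 : i₁ ≠ j₁ := ne_of_pt (by rw [p₁, q₁]; exact hself hhalf₁)
  have n12 : i₁ ≠ i₂ := ne_of_pt (by rw [p₁, p₂]; exact hne)
  have n13 : i₁ ≠ j₂ := ne_of_pt (by rw [p₁, q₂]; exact hne')
  have n21 : j₁ ≠ i₂ := ne_of_pt (by
    rw [q₁, p₂]
    intro h
    apply hne'
    rw [← h, map_sub, map_one, Complex.conj_conj, sub_sub_cancel])
  have n22 : j₁ ≠ j₂ := ne_of_pt (by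
    rw [q₁, q₂]
    intro h
    apply hne
    have := sub_right_injective h
    simpa using congrArg conj this)
  have n33 : i₂ ≠ j₂ := ne_of_pt (by rw [p₂, q₂]; exact hself hhalf₂)
  have h := sum_pairs_le hχ h1 hσ t {i₁, j₁, i₂, j₂}
  rw [Finset.sum_insert (by simp only [Finset.mem_insert, Finset.mem_singleton, not_or]; exact ⟨n11, n12, n13⟩),
    Finset.sum_insert (by simp only [Finset.mem_insert, Finset.mem_singleton, not_or]; exact ⟨n21, n22⟩),
    Finset.sum_pair n33, p₁, q₁, p₂, q₂, stF_one_sub_conj, stF_one_sub_conj, stF_one_sub_conj,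
    stF_one_sub_conj] at h
  linarith

end DirichletTheta

namespace McCurleyStechkin

open DirichletCharacter

/-! ## Lemma 10: the kept pair at `t = 0` -/

/-- **McCurley's (21)–(22).** For `1 < σ ≤ 1.3`, `½ < β ≤ 1`, `|γ| < ½`:
`[F(σ,ρ) − κF(σ₁,ρ)] ≥ (σ−β)/((σ−β)²+γ²) − 0.33`, `ρ = β + iγ`
("`−Re 1/(s−1+ρ̄) − … ≤ −(σ−1+β)/((σ−1+β)²+0.25) + κF(σ₁, β)`", the first increasing in `σ` and
`β`, "`F(σ₁,ρ) ≤ F(σ₁,β) ≤ F(σ₁,1)`" and `κF(σ₁,1) ≤ 1/σ`; McCurley: `0.3299`).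
[cite: McCurley1984ZFR, Lemma 10 (21)–(22)] -/
theorem lemma10_pair_ge {σ : ℝ} (hσ : 1 < σ) (hσ' : σ ≤ 1.3) {β γ : ℝ} (hβ : 1 / 2 < β)
    (hβ1 : β ≤ 1) (hγ : |γ| < 1 / 2) :
    (σ - β) / ((σ - β) ^ 2 + γ ^ 2) - 0.33 ≤
      ((σ - β) / ((σ - β) ^ 2 + γ ^ 2) + (σ - 1 + β) / ((σ - 1 + β) ^ 2 + γ ^ 2))
        - kappa * ((sigmaOne σ - β) / ((sigmaOne σ - β) ^ 2 + γ ^ 2)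
          + (sigmaOne σ - 1 + β) / ((sigmaOne σ - 1 + β) ^ 2 + γ ^ 2)) := by
  have hσ₁ := sigmaOne_gt_1618 hσ.le
  have hk0 := kappa_pos
  have hγ2 : γ ^ 2 < 1 / 4 := by
    have h := abs_lt.1 hγ
    nlinarith [h.1, h.2]
  -- (a) the partner term: `(σ−1+β)/((σ−1+β)²+γ²) ≥ 0.67`
  set x := σ - 1 + β with hx
  have hx0 : 1 / 2 < x := by rw [hx]; linarith
  have hx1 : x ≤ 1.3 := by rw [hx]; linarith
  have ha1 : x / (x ^ 2 + 1 / 4) ≤ x / (x ^ 2 + γ ^ 2) :=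
    div_le_div_of_nonneg_left (by linarith) (by positivity) (by linarith)
  have ha2 : (0.67 : ℝ) ≤ x / (x ^ 2 + 1 / 4) := by
    rw [le_div_iff₀ (by positivity)]
    nlinarith [mul_nonneg (sub_nonneg.2 hx0.le) (sub_nonneg.2 hx1)]
  -- (b) the `σ₁`-terms: `≤ κ[1/(σ₁−β) + 1/(σ₁−1+β)] ≤ κ[1/(σ₁−1) + 1/σ₁] ≤ 1/σ < 1`
  have hb1 : (sigmaOne σ - β) / ((sigmaOne σ - β) ^ 2 + γ ^ 2) ≤ 1 / (sigmaOne σ - β) := by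
    rw [div_le_div_iff₀ (by nlinarith) (by linarith)]
    nlinarith [sq_nonneg γ]
  have hb2 : (sigmaOne σ - 1 + β) / ((sigmaOne σ - 1 + β) ^ 2 + γ ^ 2) ≤ 1 / (sigmaOne σ - 1 + β) := by
    rw [div_le_div_iff₀ (by nlinarith) (by linarith)]
    nlinarith [sq_nonneg γ]
  have hb3 : 1 / (sigmaOne σ - β) + 1 / (sigmaOne σ - 1 + β) ≤ 1 / (sigmaOne σ - 1) + 1 / sigmaOne σ := by
    have hne1 : sigmaOne σ - 1 ≠ 0 := by linarith
    have hne2 : sigmaOne σ - β ≠ 0 := by linarith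
    have hne3 : sigmaOne σ ≠ 0 := by linarith
    have hne4 : sigmaOne σ - 1 + β ≠ 0 := by linarith
    have e : (1 / (sigmaOne σ - 1) + 1 / sigmaOne σ) - (1 / (sigmaOne σ - β) + 1 / (sigmaOne σ - 1 + β)) =
        (1 - β) * β * (2 * sigmaOne σ - 1) /
          ((sigmaOne σ - 1) * (sigmaOne σ - β) * sigmaOne σ * (sigmaOne σ - 1 + β)) := by
      field_simp
      ring
    have hnum : 0 ≤ (1 - β) * β * (2 * sigmaOne σ - 1) /
        ((sigmaOne σ - 1) * (sigmaOne σ - β) * sigmaOne σ * (sigmaOne σ - 1 + β)) := by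
      apply div_nonneg
      · have : 0 ≤ 1 - β := by linarith
        have : 0 ≤ 2 * sigmaOne σ - 1 := by linarith
        positivity
      · have h1 : 0 < sigmaOne σ - 1 := by linarith
        have h2 : 0 < sigmaOne σ - β := by linarith
        have h3 : 0 < sigmaOne σ := by linarith
        have h4 : 0 < sigmaOne σ - 1 + β := by linarith
        positivity
    linarith
  have hb4 : kappa * (1 / (sigmaOne σ - 1) + 1 / sigmaOne σ) ≤ 1 / σ := by
    have hsq := sigmaOne_sq σ
    have hkσ := kappa_mul_le_self hσ.le
    have hne1 : sigmaOne σ - 1 ≠ 0 := by linarith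
    have hne2 : sigmaOne σ ≠ 0 := by linarith
    have e : kappa * (1 / (sigmaOne σ - 1) + 1 / sigmaOne σ) =
        kappa * (2 * sigmaOne σ - 1) / (sigmaOne σ * (sigmaOne σ - 1)) := by
      field_simp
      ring
    rw [e, show sigmaOne σ * (sigmaOne σ - 1) = σ ^ 2 by nlinarith [hsq],
      div_le_div_iff₀ (by positivity) (by linarith)]
    nlinarith [hkσ]
  have hb5 : 1 / σ ≤ 1 := by rw [div_le_one (by linarith)]; exact hσ.le
  have hb : kappa * ((sigmaOne σ - β) / ((sigmaOne σ - β) ^ 2 + γ ^ 2)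
      + (sigmaOne σ - 1 + β) / ((sigmaOne σ - 1 + β) ^ 2 + γ ^ 2)) ≤ 1 := by
    calc _ ≤ kappa * (1 / (sigmaOne σ - β) + 1 / (sigmaOne σ - 1 + β)) :=
          mul_le_mul_of_nonneg_left (add_le_add hb1 hb2) hk0.le
      _ ≤ kappa * (1 / (sigmaOne σ - 1) + 1 / sigmaOne σ) := mul_le_mul_of_nonneg_left hb3 hk0.le
      _ ≤ 1 := hb4.trans hb5
  rw [← hx] at *
  linarith

variable {q : ℕ} [NeZero q] {χ : DirichletCharacter ℂ q}

/-- The Gamma term of the real-point files is `gammaDiff a σ 0`. [cite: McCurley1984ZFR, Lemma 8 (proof)] -/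
private theorem gammaDiff_zero_le (χ : DirichletCharacter ℂ q) {σ : ℝ} (hσ : 1 < σ) (hσ' : σ ≤ 1.3) :
    gammaDiff (charParity χ) σ 0 ≤ -0.44 := by
  unfold gammaDiff
  simp only [ofReal_zero, zero_mul, add_zero]
  exact gammaTerm_le χ hσ hσ'

/-- A zero has real part `≤ 1`. [cite: MontgomeryVaughan2007, Cor 10.8] -/
private theorem re_le_one_of_zero (h1 : χ ≠ 1) {ρ : ℂ} (hz : χ.LFunction ρ = 0) : ρ.re ≤ 1 := by
  by_contra h
  exact LFunction_ne_zero_of_one_le_re χ (Or.inl h1) (not_le.1 h).le hz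

/-- `F(σ, ρ) − κF(σ₁, ρ)` at `t = 0` in coordinates. [cite: McCurley1984ZFR, Lemma 4] -/
private theorem stF_pair_zero (σ : ℝ) (ρ : ℂ) :
    stF (σ + (0 : ℝ) * I) ρ - kappa * stF (sigmaOne σ + (0 : ℝ) * I) ρ =
      ((σ - ρ.re) / ((σ - ρ.re) ^ 2 + ρ.im ^ 2) + (σ - 1 + ρ.re) / ((σ - 1 + ρ.re) ^ 2 + ρ.im ^ 2))
        - kappa * ((sigmaOne σ - ρ.re) / ((sigmaOne σ - ρ.re) ^ 2 + ρ.im ^ 2)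
          + (sigmaOne σ - 1 + ρ.re) / ((sigmaOne σ - 1 + ρ.re) ^ 2 + ρ.im ^ 2)) := by
  rw [stF_eq, stF_eq, zero_sub, neg_sq]

/-- **McCurley's Lemma 10, complex character (per character).** For `χ` primitive mod `q`,
`χ ≠ 1`, `1 < σ ≤ 1.3`, and a zero `ρ = β + iγ` of `L(s, χ)` with `|γ| < ½ < β`:
`f_χ(σ) ≤ K log q − 0.44 − [(σ−β)/((σ−β)²+γ²) − 0.33]` (McCurley, for the pair `f(0,χ)+f(0,χ̄) = 2f_χ(σ)`:
`2K log k − 2(σ−β)/((σ−β)²+γ²) − 0.25418`). [cite: McCurley1984ZFR, Lemma 10] -/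
theorem lemma10_complex (hχ : χ.IsPrimitive) (h1 : χ ≠ 1) {σ : ℝ} (hσ : 1 < σ) (hσ' : σ ≤ 1.3)
    {ρ : ℂ} (hz : χ.LFunction ρ = 0) (hβ : 1 / 2 < ρ.re) (hγ : |ρ.im| < 1 / 2) :
    fdiff χ σ ≤ bigK * Real.log q - 0.44 - ((σ - ρ.re) / ((σ - ρ.re) ^ 2 + ρ.im ^ 2) - 0.33) := by
  have h := DirichletTheta.fAt_le_of_zero hχ h1 hσ.le 0 hz (by linarith) (by intro h; linarith)
  rw [fAt_zero, stF_pair_zero] at h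
  have hΓ := gammaDiff_zero_le χ hσ hσ'
  have hP := lemma10_pair_ge hσ hσ' hβ (re_le_one_of_zero h1 hz) hγ
  linarith

/-- **McCurley's Lemma 10, real character (both `ρ` and `ρ̄` kept).** For `χ` primitive mod `q`,
`χ ≠ 1`, `χ² = 1`, `1 < σ ≤ 1.3`, and a zero `ρ = β + iγ` with `γ ≠ 0`, `|γ| < ½ < β`:
`f_χ(σ) ≤ K log q − 0.44 − 2[(σ−β)/((σ−β)²+γ²) − 0.33]`
(McCurley: `K log k + 0.20281 − 2(σ−β)/((σ−β)²+γ²)`). [cite: McCurley1984ZFR, Lemma 10] -/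
theorem lemma10_real (hχ : χ.IsPrimitive) (h1 : χ ≠ 1) (h2 : χ ^ 2 = 1) {σ : ℝ} (hσ : 1 < σ)
    (hσ' : σ ≤ 1.3) {ρ : ℂ} (hz : χ.LFunction ρ = 0) (hβ : 1 / 2 < ρ.re) (hγ0 : ρ.im ≠ 0)
    (hγ : |ρ.im| < 1 / 2) :
    fdiff χ σ ≤ bigK * Real.log q - 0.44 - 2 * ((σ - ρ.re) / ((σ - ρ.re) ^ 2 + ρ.im ^ 2) - 0.33) := by
  have hz' := DirichletZFR.LFunction_conj_eq_zero χ h1 h2 hz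
  have hne : ρ ≠ conj ρ := fun h ↦ by
    have := congrArg Complex.im h
    rw [conj_im] at this
    exact hγ0 (by linarith)
  have hne' : ρ ≠ 1 - conj (conj ρ) := fun h ↦ by
    have := congrArg Complex.re h
    rw [Complex.conj_conj, sub_re, one_re] at this
    linarith
  have h := DirichletTheta.fAt_le_of_two_zeros hχ h1 hσ.le 0 hz (by linarith) (by intro h; linarith)
    hz' (by rw [conj_re]; linarith) (by rw [conj_re]; intro h; linarith) hne hne'
  rw [fAt_zero, stF_pair_zero, stF_pair_zero, conj_re, conj_im, neg_sq] at h
  have hΓ := gammaDiff_zero_le χ hσ hσ'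
  have hβ1 := re_le_one_of_zero h1 hz
  have hP := lemma10_pair_ge hσ hσ' hβ hβ1 hγ
  linarith

/-! ## Positivity at a real point for a polynomial in `Re χ`, `Re χ²` -/

section Positivity

open LSeries ArithmeticFunction

variable {k : ℕ} [NeZero k]

/-- **Positivity at a real point.** If `c₀ + c₁ Re χ(u) + c₂ Re χ²(u) ≥ 0` for every unit `u` mod `k`,
then `0 ≤ c₀ f_{χ₀}(σ) + c₁ f_χ(σ) + c₂ f_{χ²}(σ)` for `σ > 1` (the combined Dirichlet series has the
non-negative terms `Λ(n)(n^{−σ} − κn^{−σ₁})[c₀ + c₁Re χ(n) + c₂Re χ²(n)]`).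
[cite: McCurley1984ZFR, §6 ((43), (47) and the order-4 inequality)] -/
theorem positivity_poly (χ : DirichletCharacter ℂ k) {c₀ c₁ c₂ : ℝ}
    (hP : ∀ u : (ZMod k)ˣ, 0 ≤ c₀ + c₁ * (χ u).re + c₂ * ((χ ^ 2) u).re) {σ : ℝ} (hσ : 1 < σ) :
    0 ≤ c₀ * fdiff (1 : DirichletCharacter ℂ k) σ + c₁ * fdiff χ σ + c₂ * fdiff (χ ^ 2) σ := by
  have hσ₁ : 1 < sigmaOne σ := one_lt_sigmaOne hσ.le
  have hσσ₁ : σ ≤ sigmaOne σ := (lt_sigmaOne (show (0 : ℝ) < σ by linarith)).le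
  have S : ∀ (c : ℝ) (ψ : DirichletCharacter ℂ k), HasSum (fun n : ℕ ↦
      c * ((Λ n : ℝ) * (ψ (n : ZMod k)).re / (n : ℝ) ^ σ)
      - c * (kappa * ((Λ n : ℝ) * (ψ (n : ZMod k)).re / (n : ℝ) ^ sigmaOne σ)))
      (c * fdiff ψ σ) := by
    intro c ψ
    have h := ((hasSum_re_twist ψ hσ).mul_left c).sub
      (((hasSum_re_twist ψ hσ₁).mul_left kappa).mul_left c)
    unfold fdiff
    rw [mul_sub]
    exact h
  have hS := ((S c₀ 1).add (S c₁ χ)).add (S c₂ (χ ^ 2))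
  refine hS.nonneg fun n ↦ ?_
  set a := (Λ n : ℝ) with hadef
  set u := (n : ℝ) ^ σ with hudef
  set v := (n : ℝ) ^ sigmaOne σ with hvdef
  have ha : 0 ≤ a := vonMangoldt_nonneg
  have hw : 0 ≤ 1 / u - kappa * (1 / v) := by
    rcases Nat.eq_zero_or_pos n with hn | hn
    · have hu0 : u = 0 := by rw [hudef, hn, Nat.cast_zero, Real.zero_rpow (by linarith)]
      have hv0 : v = 0 := by rw [hvdef, hn, Nat.cast_zero, Real.zero_rpow (by linarith)]
      simp [hu0, hv0]
    · have hn1 : (1 : ℝ) ≤ n := by exact_mod_cast hn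
      have hupos : 0 < u := Real.rpow_pos_of_pos (by linarith) _
      have huv : u ≤ v := Real.rpow_le_rpow_of_exponent_le hn1 hσσ₁
      have h1 : 1 / v ≤ 1 / u := one_div_le_one_div_of_le hupos huv
      have h2 : 0 ≤ 1 / v := by positivity
      nlinarith [kappa_lt_one, kappa_pos]
  set x0 := ((1 : DirichletCharacter ℂ k) (n : ZMod k)).re
  set x1 := (χ (n : ZMod k)).re
  set x2 := ((χ ^ 2) (n : ZMod k)).re
  have hPn : 0 ≤ c₀ * x0 + c₁ * x1 + c₂ * x2 := by
    by_cases hu : IsUnit (n : ZMod k)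
    · obtain ⟨w, hw'⟩ := hu
      have e0 : x0 = 1 := by simp only [x0, ← hw', MulChar.one_apply_coe, Complex.one_re]
      have e1 : x1 = (χ w).re := by simp only [x1, ← hw']
      have e2 : x2 = ((χ ^ 2) w).re := by simp only [x2, ← hw']
      rw [e0, e1, e2, mul_one]
      exact hP w
    · simp only [x0, x1, x2, MulChar.map_nonunit _ hu, Complex.zero_re, mul_zero, add_zero, le_refl]
  have key : 0 ≤ a * (1 / u - kappa * (1 / v)) * (c₀ * x0 + c₁ * x1 + c₂ * x2) :=
    mul_nonneg (mul_nonneg ha hw) hPn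
  have e2 : a * (1 / u - kappa * (1 / v)) * (c₀ * x0 + c₁ * x1 + c₂ * x2)
      = (c₀ * (a * x0 / u) - c₀ * (kappa * (a * x0 / v)))
        + (c₁ * (a * x1 / u) - c₁ * (kappa * (a * x1 / v)))
        + (c₂ * (a * x2 / u) - c₂ * (kappa * (a * x2 / v))) := by ring
  linarith [key, e2]

omit [NeZero k] in
/-- `Re z²  = 2(Re z)² − 1` and `z⁻¹ = z̄` for a character value at a unit. [folklore] -/
private theorem unit_value_aux (χ : DirichletCharacter ℂ k) (u : (ZMod k)ˣ) :
    ((χ u) ^ 2).re = 2 * (χ u).re ^ 2 - 1 ∧ (χ u)⁻¹ = conj (χ u) := by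
  have hn : ‖χ u‖ = 1 := χ.unit_norm_eq_one u
  have hsq : (χ u).re ^ 2 + (χ u).im ^ 2 = 1 := by
    have h := Complex.sq_norm (χ u)
    rw [hn, one_pow, Complex.normSq_apply] at h
    nlinarith [h]
  refine ⟨re_pow_two_of_unit hsq, ?_⟩
  rw [Complex.inv_def, ← Complex.sq_norm, hn, one_pow, inv_one, Complex.ofReal_one, mul_one]

omit [NeZero k] in
/-- For `1 + Re χ(u) ≥ 0` (every character). [cite: McCurley1984ZFR, §6 (47)] -/
theorem one_add_re_nonneg (χ : DirichletCharacter ℂ k) (u : (ZMod k)ˣ) :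
    0 ≤ 1 + 1 * (χ u).re + 0 * ((χ ^ 2) u).re := by
  have h := (Complex.abs_re_le_norm (χ u)).trans (χ.norm_le_one u)
  have := (abs_le.1 h).1
  linarith

omit [NeZero k] in
/-- **Cubic characters**: `χ³ = χ₀` ⇒ `1 + 2Re χ(u) ≥ 0` (`χ(u) ∈ {1, e^{±2πi/3}}`; (43) at the values
of a cubic character: `5 + 8cos θ + 4cos 2θ + cos 3θ = 6 + 12cos θ`). [cite: McCurley1984ZFR, §6 and (43)] -/
theorem re_poly_nonneg_of_cube_eq_one (χ : DirichletCharacter ℂ k) (h3 : χ ^ 3 = 1) (u : (ZMod k)ˣ) :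
    0 ≤ 1 + 2 * (χ u).re + 0 * ((χ ^ 2) u).re := by
  obtain ⟨hre2, hinv⟩ := unit_value_aux χ u
  set z := χ u with hz
  have hz3 : z ^ 3 = 1 := by rw [hz, ← MulChar.pow_apply_coe, h3, MulChar.one_apply_coe]
  have hz0 : z ≠ 0 := fun h ↦ by rw [h] at hz3; norm_num at hz3
  -- `z² = z⁻¹ = z̄`, so `Re z² = Re z`: `2x² − 1 = x`, `(2x+1)(x−1) = 0`
  have hz2 : z ^ 2 = conj z := by
    rw [← hinv]
    have : z * z ^ 2 = 1 := by rw [← pow_succ']; exact hz3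
    exact (eq_inv_of_mul_eq_one_right this)
  have hx : 2 * z.re ^ 2 - 1 = z.re := by rw [← hre2, hz2, conj_re]
  have hfac : (2 * z.re + 1) * (z.re - 1) = 0 := by nlinarith [hx]
  rcases mul_eq_zero.1 hfac with h | h <;> nlinarith [h]

omit [NeZero k] in
/-- **Quartic characters**: `χ⁴ = χ₀` ⇒ `1 + 2Re χ(u) + Re χ²(u) ≥ 0` (`χ(u) ∈ {±1, ±i}`, the values
`4, 0, 0, 0` of `(1 + Re χ)(1 + Re χ²)`). [cite: McCurley1984ZFR, §6 (the inequality for order 4)] -/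
theorem re_poly_nonneg_of_fourth_eq_one (χ : DirichletCharacter ℂ k) (h4 : χ ^ 4 = 1)
    (u : (ZMod k)ˣ) : 0 ≤ 1 + 2 * (χ u).re + 1 * ((χ ^ 2) u).re := by
  obtain ⟨hre2, -⟩ := unit_value_aux χ u
  set z := χ u with hz
  have hz4 : z ^ 4 = 1 := by rw [hz, ← MulChar.pow_apply_coe, h4, MulChar.one_apply_coe]
  have e2 : (χ ^ 2) u = z ^ 2 := by rw [hz, ← MulChar.pow_apply_coe]
  rw [e2, hre2, one_mul]
  have hfac : (z ^ 2 - 1) * (z ^ 2 + 1) = 0 := by ring_nf; rw [hz4]; ring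
  rcases mul_eq_zero.1 hfac with h | h
  · have h' : z ^ 2 = 1 := sub_eq_zero.1 h
    have hx : 2 * z.re ^ 2 - 1 = 1 := by rw [← hre2, h', one_re]
    have hx1 : z.re ^ 2 = 1 := by linarith
    have habs : -1 ≤ z.re := by nlinarith [hx1]
    nlinarith [hx1, habs]
  · have h' : z ^ 2 = -1 := eq_neg_of_add_eq_zero_left h
    have hx : 2 * z.re ^ 2 - 1 = -1 := by rw [← hre2, h', neg_re, one_re]
    have hx0 : z.re = 0 := by nlinarith
    rw [hx0]; norm_num

end Positivity

/-! ## The imprimitive penalty of `χ²` (Lemma 9): `Σ_{p∣k} max(G(p,σ), 0) ≤ 1.07` -/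

section Penalty

/-- `log 3 ≤ 1.0986124`. [folklore] -/
private theorem log_three_le : Real.log 3 ≤ 1.0986124 := by
  rw [Real.log_le_iff_le_exp (by norm_num)]
  have h1 : Real.exp 1.0986124 = Real.exp 1 * Real.exp 0.0986124 := by rw [← Real.exp_add]; norm_num
  have h2 : (1.1036384 : ℝ) ≤ Real.exp 0.0986124 := by
    have h := Real.sum_le_exp_of_nonneg (x := (0.0986124 : ℝ)) (by norm_num) 6
    refine le_trans ?_ h
    simp only [Finset.sum_range_succ, Finset.sum_range_zero, Nat.factorial]
    norm_num
  rw [h1]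
  have he := Real.exp_one_gt_d9
  nlinarith

/-- `log 5 ≤ 1.609438`. [folklore] -/
private theorem log_five_le : Real.log 5 ≤ 1.609438 := by
  rw [Real.log_le_iff_le_exp (by norm_num)]
  have h1 : Real.exp 1.609438 = Real.exp 1 * Real.exp 0.609438 := by rw [← Real.exp_add]; norm_num
  have h2 : (1.8393973 : ℝ) ≤ Real.exp 0.609438 := by
    have h := Real.sum_le_exp_of_nonneg (x := (0.609438 : ℝ)) (by norm_num) 9
    refine le_trans ?_ h
    simp only [Finset.sum_range_succ, Finset.sum_range_zero, Nat.factorial]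
    norm_num
  rw [h1]
  have he := Real.exp_one_gt_d9
  nlinarith

/-- `1.09861 ≤ log 3`. [folklore] -/
private theorem log_three_ge'' : (1.09861 : ℝ) ≤ Real.log 3 := by
  rw [Real.le_log_iff_exp_le (by norm_num)]
  have h1 : Real.exp 1.09861 = Real.exp 1 * Real.exp 0.09861 := by rw [← Real.exp_add]; norm_num
  have h2 : Real.exp 0.09861 ≤ 1.103637 := by
    have h := Real.exp_bound' (x := (0.09861 : ℝ)) (by norm_num) (by norm_num) (n := 4) (by norm_num)
    refine h.trans ?_
    simp only [Finset.sum_range_succ, Finset.sum_range_zero, Nat.factorial]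
    norm_num
  rw [h1]
  have := Real.exp_one_lt_d9
  nlinarith [Real.exp_pos 0.09861]

/-- `1.609437 ≤ log 5`. [folklore] -/
private theorem log_five_ge'' : (1.609437 : ℝ) ≤ Real.log 5 := by
  rw [Real.le_log_iff_exp_le (by norm_num)]
  have h1 : Real.exp 1.609437 = Real.exp 1 * Real.exp 0.609437 := by rw [← Real.exp_add]; norm_num
  have h2 : Real.exp 0.609437 ≤ 1.839396 := by
    have h := Real.exp_bound' (x := (0.609437 : ℝ)) (by norm_num) (by norm_num) (n := 7) (by norm_num)
    refine h.trans ?_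
    simp only [Finset.sum_range_succ, Finset.sum_range_zero, Nat.factorial]
    norm_num
  rw [h1]
  have := Real.exp_one_lt_d9
  nlinarith [Real.exp_pos 0.609437]

/-- `1.41421 < √2`, `1.73205 < √3`, `2.236 < √5`. [folklore] -/
private theorem sqrt_lower_bounds :
    (1.41421 : ℝ) < Real.sqrt 2 ∧ (1.73205 : ℝ) < Real.sqrt 3 ∧ (2.236 : ℝ) < Real.sqrt 5 := by
  refine ⟨?_, ?_, ?_⟩
  · rw [show (1.41421 : ℝ) = Real.sqrt (1.41421 ^ 2) by rw [Real.sqrt_sq (by norm_num)]]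
    exact Real.sqrt_lt_sqrt (by norm_num) (by norm_num)
  · rw [show (1.73205 : ℝ) = Real.sqrt (1.73205 ^ 2) by rw [Real.sqrt_sq (by norm_num)]]
    exact Real.sqrt_lt_sqrt (by norm_num) (by norm_num)
  · rw [show (2.236 : ℝ) = Real.sqrt (2.236 ^ 2) by rw [Real.sqrt_sq (by norm_num)]]
    exact Real.sqrt_lt_sqrt (by norm_num) (by norm_num)

/-- Generic per-prime bound: `max(G(p,σ),0) ≤ max(A/(p−1) + κ⁺·A/(p·s − 1) − K⁻·B, 0)` from
`B ≤ log p ≤ A`, `s ≤ √p`. [cite: McCurley1984ZFR, Lemma 9 (proof)] -/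
private theorem max_gPen_le_of {p : ℕ} (hp : 2 ≤ p) {σ : ℝ} (hσ : 1 < σ) {A B s : ℝ}
    (hA : Real.log p ≤ A) (hB : B ≤ Real.log p) (hB0 : 0 ≤ B) (hs : s ≤ Real.sqrt p)
    (hs1 : 1 < (p : ℝ) * s) :
    max (gPen p σ) 0 ≤ max (A / ((p : ℝ) - 1) + 0.44723 * (A / ((p : ℝ) * s - 1)) - 0.276385 * B) 0 := by
  refine max_le_max ?_ le_rfl
  have hp1 : (1 : ℝ) < p := by exact_mod_cast hp
  have hp0 : (0 : ℝ) < p := by linarith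
  have hlog0 : 0 ≤ Real.log p := Real.log_nonneg hp1.le
  have hU := uCorr_le_of_one_le hp hσ.le
  have hU1 := uCorr_sigmaOne_le hp hσ.le
  have hden : (p : ℝ) * s - 1 ≤ (p : ℝ) * Real.sqrt p - 1 := by nlinarith
  have h1 : uCorr p σ ≤ A / ((p : ℝ) - 1) :=
    hU.trans (div_le_div_of_nonneg_right hA (by linarith))
  have h2 : uCorr p (sigmaOne σ) ≤ A / ((p : ℝ) * s - 1) := by
    refine hU1.trans ?_
    calc Real.log p / ((p : ℝ) * Real.sqrt p - 1) ≤ Real.log p / ((p : ℝ) * s - 1) :=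
          div_le_div_of_nonneg_left hlog0 (by linarith) hden
      _ ≤ A / ((p : ℝ) * s - 1) := div_le_div_of_nonneg_right hA (by linarith)
  have hU10 : 0 ≤ uCorr p (sigmaOne σ) := uCorr_nonneg hp (by linarith [one_lt_sigmaOne hσ.le])
  unfold gPen
  have hk := kappa_lt
  have hK := bigK_gt
  have h3 : kappa * uCorr p (sigmaOne σ) ≤ 0.44723 * (A / ((p : ℝ) * s - 1)) := by
    calc kappa * uCorr p (sigmaOne σ) ≤ kappa * (A / ((p : ℝ) * s - 1)) :=
          mul_le_mul_of_nonneg_left h2 kappa_pos.le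
      _ ≤ 0.44723 * (A / ((p : ℝ) * s - 1)) :=
          mul_le_mul_of_nonneg_right hk.le (hU10.trans h2)
  have h4 : 0.276385 * B ≤ bigK * Real.log p := by
    calc 0.276385 * B ≤ bigK * B := mul_le_mul_of_nonneg_right hK.le hB0
      _ ≤ bigK * Real.log p := mul_le_mul_of_nonneg_left hB bigK_pos.le
  linarith

/-- `max(G(2,σ), 0) ≤ 0.6712` (`1 < σ`). [cite: McCurley1984ZFR, Lemma 9 (proof: the prime 2)] -/
theorem max_gPen_two_le {σ : ℝ} (hσ : 1 < σ) : max (gPen 2 σ) 0 ≤ 0.6712 := by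
  obtain ⟨hs2, -, -⟩ := sqrt_lower_bounds
  have h := max_gPen_le_of (p := 2) le_rfl hσ (A := 0.6931471808) (B := 0.6931471803) (s := 1.41421)
    (by exact_mod_cast Real.log_two_lt_d9.le) (by exact_mod_cast Real.log_two_gt_d9.le) (by norm_num)
    (by exact_mod_cast hs2.le) (by norm_num)
  refine h.trans (max_le ?_ (by norm_num))
  norm_num

/-- `max(G(3,σ), 0) ≤ 0.3628` (`1 < σ`). [cite: McCurley1984ZFR, Lemma 9 (proof: the prime 3)] -/
theorem max_gPen_three_le {σ : ℝ} (hσ : 1 < σ) : max (gPen 3 σ) 0 ≤ 0.3628 := by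
  obtain ⟨-, hs3, -⟩ := sqrt_lower_bounds
  have h := max_gPen_le_of (p := 3) (by norm_num) hσ (A := 1.0986124) (B := 1.09861) (s := 1.73205)
    (by exact_mod_cast log_three_le) (by exact_mod_cast log_three_ge'') (by norm_num)
    (by exact_mod_cast hs3.le) (by norm_num)
  refine h.trans (max_le ?_ (by norm_num))
  norm_num

/-- `max(G(5,σ), 0) ≤ 0.0283` (`1 < σ`). [cite: McCurley1984ZFR, Lemma 9 (proof)] -/
theorem max_gPen_five_le {σ : ℝ} (hσ : 1 < σ) : max (gPen 5 σ) 0 ≤ 0.0283 := by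
  obtain ⟨-, -, hs5⟩ := sqrt_lower_bounds
  have h := max_gPen_le_of (p := 5) (by norm_num) hσ (A := 1.609438) (B := 1.609437) (s := 2.236)
    (by exact_mod_cast log_five_le) (by exact_mod_cast log_five_ge'') (by norm_num)
    (by exact_mod_cast hs5.le) (by norm_num)
  refine h.trans (max_le ?_ (by norm_num))
  norm_num

/-- **The penalty of an induced power**: for every modulus `k` and `σ > 1`,
`Σ_{p∣k} max(G(p,σ), 0) ≤ 1.07` (only `p = 2, 3, 5` contribute; McCurley's Lemma 9 has `1.1257/2`
for a real induced character). [cite: McCurley1984ZFR, Lemma 9] -/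
theorem sum_max_gPen_le (k : ℕ) {σ : ℝ} (hσ : 1 < σ) :
    ∑ p ∈ k.primeFactors, max (gPen p σ) 0 ≤ 1.07 := by
  classical
  set b : ℕ → ℝ := fun p ↦ if p = 2 then 0.6712 else if p = 3 then 0.3628 else if p = 5 then 0.0283 else 0
    with hbdef
  have hb0 : ∀ p, 0 ≤ b p := by
    intro p; simp only [hbdef]; split_ifs <;> norm_num
  have hle : ∀ p ∈ k.primeFactors, max (gPen p σ) 0 ≤ b p := by
    intro p hp
    have hpP := Nat.prime_of_mem_primeFactors hp
    simp only [hbdef]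
    by_cases h2 : p = 2
    · subst h2; rw [if_pos rfl]; exact max_gPen_two_le hσ
    by_cases h3 : p = 3
    · subst h3; rw [if_neg (by norm_num), if_pos rfl]; exact max_gPen_three_le hσ
    by_cases h5 : p = 5
    · subst h5; rw [if_neg (by norm_num), if_neg (by norm_num), if_pos rfl]; exact max_gPen_five_le hσ
    have h7 : 7 ≤ p := by
      have h2' := hpP.two_le
      by_contra hlt
      have hlt' : p < 7 := not_le.1 hlt
      interval_cases p
      all_goals first | omega | exact absurd hpP (by decide)
    rw [if_neg h2, if_neg h3, if_neg h5]
    exact le_of_eq (max_eq_right (gPen_nonpos_of_seven_le h7 hσ))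
  have hsub : ∑ p ∈ k.primeFactors, b p ≤ ∑ p ∈ ({2, 3, 5} : Finset ℕ), b p := by
    have hsplit : ∑ p ∈ k.primeFactors, b p =
        ∑ p ∈ k.primeFactors.filter (fun p ↦ p ∈ ({2, 3, 5} : Finset ℕ)), b p := by
      rw [Finset.sum_filter]
      refine Finset.sum_congr rfl fun p _ ↦ ?_
      by_cases h : p ∈ ({2, 3, 5} : Finset ℕ)
      · rw [if_pos h]
      · rw [if_neg h]
        simp only [Finset.mem_insert, Finset.mem_singleton, not_or] at h
        simp [hbdef, h.1, h.2.1, h.2.2]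
    rw [hsplit]
    exact Finset.sum_le_sum_of_subset_of_nonneg (fun p hp ↦ (Finset.mem_filter.1 hp).2)
      fun p _ _ ↦ hb0 p
  have hval : ∑ p ∈ ({2, 3, 5} : Finset ℕ), b p = 1.0623 := by
    simp [hbdef]; norm_num
  calc ∑ p ∈ k.primeFactors, max (gPen p σ) 0 ≤ ∑ p ∈ k.primeFactors, b p := Finset.sum_le_sum hle
    _ ≤ 1.0623 := by rw [← hval]; exact hsub
    _ ≤ 1.07 := by norm_num

end Penalty

/-! ## The optimisation in `r, b, c` -/

/-- **The endgame of §6.** With `L > 0`, `σ = 1 + r/L`, `1 − b₀/L ≤ β < 1`, `|γ| L ≤ c₀`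
(`0 ≤ c₀ < r`, `b₀ ≥ 0`), the inequality `2(σ−β)/((σ−β)²+γ²) ≤ A·L` contradicts
`A < 2(r+b₀)/((r+b₀)²+c₀²)` ("the left side of (46) is decreasing in `b` and `c`").
[cite: McCurley1984ZFR, §6 (46)] -/
theorem endgame_pair {σ β γ L r b₀ c₀ A : ℝ} (hL : 0 < L) (hr : c₀ < r) (hc₀ : 0 ≤ c₀) (hb₀ : 0 ≤ b₀)
    (hσ : σ = 1 + r / L) (hβ1 : β < 1) (hβ : 1 - b₀ / L ≤ β) (hγ : |γ| * L ≤ c₀)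
    (hmain : 2 * (σ - β) / ((σ - β) ^ 2 + γ ^ 2) ≤ A * L)
    (hnum : A < 2 * (r + b₀) / ((r + b₀) ^ 2 + c₀ ^ 2)) : False := by
  set u := (σ - β) * L with hu
  set c := |γ| * L with hc
  have hd : 0 < σ - β := by rw [hσ]; have : 0 < r / L := div_pos (by linarith) hL; linarith
  have hu_lo : r < u := by
    rw [hu, hσ]
    have : (1 + r / L - β) * L = r + (1 - β) * L := by field_simp; ring
    rw [this]; nlinarith
  have hu_hi : u ≤ r + b₀ := by
    rw [hu, hσ]
    have e : (1 + r / L - β) * L = r + (1 - β) * L := by field_simp; ring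
    rw [e]
    have : (1 - β) * L ≤ b₀ := by
      have h := mul_le_mul_of_nonneg_right hβ hL.le
      have e2 : (1 - b₀ / L) * L = L - b₀ := by field_simp
      rw [e2] at h; nlinarith
    linarith
  have hc0 : 0 ≤ c := by rw [hc]; positivity
  have hu0 : 0 < u := by linarith
  -- `2u ≤ A(u² + c²)` from `hmain`
  have hden : 0 < (σ - β) ^ 2 + γ ^ 2 := by positivity
  have h1 : 2 * (σ - β) ≤ A * L * ((σ - β) ^ 2 + γ ^ 2) := (div_le_iff₀ hden).1 hmain
  have h2 : 2 * u ≤ A * (u ^ 2 + c ^ 2) := by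
    have e1 : u ^ 2 + c ^ 2 = ((σ - β) ^ 2 + γ ^ 2) * L ^ 2 := by
      rw [hu, hc, mul_pow, mul_pow, sq_abs]; ring
    have h1' := mul_le_mul_of_nonneg_right h1 hL.le
    rw [e1]
    calc 2 * u = 2 * (σ - β) * L := by rw [hu]; ring
      _ ≤ A * L * ((σ - β) ^ 2 + γ ^ 2) * L := h1'
      _ = A * (((σ - β) ^ 2 + γ ^ 2) * L ^ 2) := by ring
  -- `A > 0`, `c² ≤ c₀²`
  have hA : 0 < A := by
    by_contra h
    have : A * (u ^ 2 + c ^ 2) ≤ 0 := mul_nonpos_of_nonpos_of_nonneg (not_lt.1 h) (by positivity)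
    linarith
  have hcc : c ^ 2 ≤ c₀ ^ 2 := pow_le_pow_left₀ hc0 hγ 2
  have h3 : 2 * u ≤ A * (u ^ 2 + c₀ ^ 2) := by nlinarith
  -- `hnum`: `A((r+b₀)² + c₀²) < 2(r+b₀)`
  have hrb : 0 < r + b₀ := by linarith
  have hpos0 : 0 < (r + b₀) ^ 2 + c₀ ^ 2 := by positivity
  have h4 : A * ((r + b₀) ^ 2 + c₀ ^ 2) < 2 * (r + b₀) := (lt_div_iff₀ hpos0).1 hnum
  -- monotonicity: `(u₀ − u)(u u₀ − c₀²) ≥ 0`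
  have hmono : 0 ≤ ((r + b₀) - u) * (u * (r + b₀) - c₀ ^ 2) := by
    apply mul_nonneg (by linarith)
    nlinarith [mul_le_mul hr.le hr.le hc₀ (by linarith : (0:ℝ) ≤ r)]
  have hpos1 : 0 < u ^ 2 + c₀ ^ 2 := by positivity
  nlinarith [mul_le_mul_of_nonneg_left h3 hpos0.le, mul_lt_mul_of_pos_left h4 hpos1, hmono, hA]

/-! ## §6: the three clauses -/

section Clauses

variable {k : ℕ} [NeZero k] {χ : DirichletCharacter ℂ k}

/-- `log 10 ≥ 2.30258`. [folklore] -/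
private theorem log_ten_ge' : (2.30258 : ℝ) ≤ Real.log 10 := by
  have h : Real.log 10 = Real.log 2 + Real.log 5 := by
    rw [show (10 : ℝ) = 2 * 5 by norm_num, Real.log_mul (by norm_num) (by norm_num)]
  rw [h]
  have h2 := Real.log_two_gt_d9
  have h5 := log_five_ge''
  linarith

/-- `s_k(σ) ≥ 0`. [cite: McCurley1984ZFR, §2 ("s(k) > 0")] -/
private theorem sum_help_nonneg' (k : ℕ) {σ : ℝ} (hσ : 1 < σ) :
    0 ≤ ∑ p ∈ k.primeFactors, (uCorr p σ - kappa * uCorr p (sigmaOne σ)) :=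
  Finset.sum_nonneg fun _ hp ↦ help_nonneg (Nat.prime_of_mem_primeFactors hp).two_le hσ

/-- The common bookkeeping of §6: from the window assumption to the parameters of Lemma 10 and
of the endgame. [cite: McCurley1984ZFR, §6] -/
private theorem setup {L r c₀ : ℝ} (hL10 : Real.log 10 ≤ L) (hr0 : 0 < r) (hr : r ≤ 0.69)
    (hc₀ : c₀ ≤ 0.538) {β γ : ℝ} (hβ : 1 - 1 / (9.645908801 * L) ≤ β) (hγ : |γ| * L ≤ c₀) :
    0 < L ∧ 1 < 1 + r / L ∧ 1 + r / L ≤ 1.3 ∧ 1 / 2 < β ∧ |γ| < 1 / 2 ∧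
      1 - (1 / 9.645908801) / L ≤ β ∧ 1 / (1 + r / L - 1) = L / r := by
  have hL : 2.30258 ≤ L := log_ten_ge'.trans hL10
  have hL0 : 0 < L := by linarith
  refine ⟨hL0, by have := div_pos hr0 hL0; linarith, ?_, ?_, ?_, ?_, ?_⟩
  · have : r / L ≤ 0.69 / 2.30258 := div_le_div₀ (by norm_num) hr (by norm_num) hL
    have h2 : (0.69 : ℝ) / 2.30258 ≤ 0.3 := by norm_num
    linarith
  · have h1 : 1 / (9.645908801 * L) ≤ 1 / (9.645908801 * 2.30258) :=
      one_div_le_one_div_of_le (by norm_num) (by nlinarith)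
    have h2 : (1 : ℝ) / (9.645908801 * 2.30258) < 1 / 2 := by norm_num
    linarith
  · have h1 : |γ| ≤ c₀ / L := by rw [le_div_iff₀ hL0]; exact hγ
    have h2 : c₀ / L ≤ 0.538 / 2.30258 := by
      rcases le_or_gt 0 c₀ with hc | hc
      · exact div_le_div₀ (by norm_num) hc₀ (by norm_num) hL
      · have : c₀ / L < 0 := div_neg_of_neg_of_pos hc hL0
        have : (0 : ℝ) ≤ 0.538 / 2.30258 := by norm_num
        linarith
    have h3 : (0.538 : ℝ) / 2.30258 < 1 / 2 := by norm_num
    linarith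
  · have e : 1 / (9.645908801 * L) = (1 / 9.645908801) / L := by
      rw [div_div]
    rw [← e]; exact hβ
  · have hne : r ≠ 0 := hr0.ne'
    have hLne : L ≠ 0 := hL0.ne'
    rw [add_sub_cancel_left, one_div_div]

/-- **McCurley's Theorem 1, §6 clause for cubic characters.** Let `χ` be a primitive character
mod `k` with `χ³ = χ₀`, `χ ≠ χ₀`, `L ≥ log k`, `L ≥ log 10`, and `ρ = β + iγ` a zero of `L(s, χ)`
with `|γ|·L ≤ 0.403`. Then `β < 1 − 1/(R L)`, `R = 9.645908801` (inequality
`f(0,χ₀) + f(0,χ) + f(0,χ̄) ≥ 0` from (43), Lemmas 3 and 10, `σ = 1 + 0.69/L`: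
`2(r+b)/((r+b)² + c²) < 1/r + 2K` forces `b > 0.104 > 1/R`).
[cite: McCurley1984ZFR, §6 (order 3) and Theorem 1] -/
theorem order_three_small_height (hχ : χ.IsPrimitive) (h1 : χ ≠ 1) (h3 : χ ^ 3 = 1) {L : ℝ}
    (hLk : Real.log k ≤ L) (hL10 : Real.log 10 ≤ L) {ρ : ℂ} (hz : χ.LFunction ρ = 0)
    (hγ : |ρ.im| * L ≤ 0.403) :
    ρ.re < 1 - 1 / (9.645908801 * L) := by
  by_contra hcon
  have hβw := not_lt.1 hcon
  obtain ⟨hL0, hσ, hσ', hβ, hγ', hβ', hinv⟩ :=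
    setup hL10 (by norm_num : (0:ℝ) < 0.69) le_rfl (by norm_num : (0.403:ℝ) ≤ 0.538) hβw hγ
  set σ := 1 + 0.69 / L with hσdef
  -- positivity with `1 + 2cos θ`
  have hpos := positivity_poly χ (re_poly_nonneg_of_cube_eq_one χ h3) hσ
  simp only [zero_mul, add_zero, one_mul] at hpos
  -- Lemma 3 and Lemma 10
  have hζ := fdiff_principal_le_sharp13 (k := k) hσ hσ'
  have hs := sum_help_nonneg' k hσ
  have h10 := lemma10_complex hχ h1 hσ hσ' hz hβ hγ'
  have hK := bigK_pos
  have hKL : bigK * Real.log k ≤ bigK * L := mul_le_mul_of_nonneg_left hLk hK.le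
  -- main inequality `2(σ−β)/((σ−β)²+γ²) ≤ (1/r + 2K) L`
  have hmain : 2 * (σ - ρ.re) / ((σ - ρ.re) ^ 2 + ρ.im ^ 2) ≤ (1 / 0.69 + 2 * bigK) * L := by
    have e : 2 * (σ - ρ.re) / ((σ - ρ.re) ^ 2 + ρ.im ^ 2) =
        2 * ((σ - ρ.re) / ((σ - ρ.re) ^ 2 + ρ.im ^ 2)) := by ring
    rw [e]
    rw [hinv] at hζ
    have h' : 2 * ((σ - ρ.re) / ((σ - ρ.re) ^ 2 + ρ.im ^ 2)) ≤ L / 0.69 + 2 * (bigK * L) := by linarith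
    calc _ ≤ L / 0.69 + 2 * (bigK * L) := h'
      _ = (1 / 0.69 + 2 * bigK) * L := by ring
  have hβ1 : ρ.re < 1 := by
    by_contra h
    exact LFunction_ne_zero_of_one_le_re χ (Or.inl h1) (not_lt.1 h) hz
  refine endgame_pair (A := 1 / 0.69 + 2 * bigK) (b₀ := 1 / 9.645908801) (c₀ := 0.403) hL0
    (by norm_num) (by norm_num) (by norm_num) hσdef hβ1 hβ' hγ hmain ?_
  have hK' := bigK_lt
  have : (1 : ℝ) / 0.69 + 2 * 0.276395 < 2 * (0.69 + 1 / 9.645908801) / ((0.69 + 1 / 9.645908801) ^ 2 + 0.403 ^ 2) := by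
    norm_num
  linarith

/-- **McCurley's Theorem 1, §6 clause for real characters (complex zeros of small height).** Let
`χ` be a primitive character mod `k` with `χ² = χ₀`, `χ ≠ χ₀`, `L ≥ log k`, `L ≥ log 10`, and
`ρ = β + iγ` a zero of `L(s, χ)` with `γ ≠ 0`, `|γ|·L ≤ 0.538`. Then `β < 1 − 1/(R L)`
(`1 + cos θ ≥ 0`, Lemmas 3 and 10 with both `ρ, ρ̄` kept, `σ = 1 + 0.69/L`:
`2(r+b)/((r+b)²+c²) < 1/r + K`). [cite: McCurley1984ZFR, §6 (order 2, (47)) and Theorem 1] -/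
theorem order_two_small_height (hχ : χ.IsPrimitive) (h1 : χ ≠ 1) (h2 : χ ^ 2 = 1) {L : ℝ}
    (hLk : Real.log k ≤ L) (hL10 : Real.log 10 ≤ L) {ρ : ℂ} (hz : χ.LFunction ρ = 0)
    (hγ0 : ρ.im ≠ 0) (hγ : |ρ.im| * L ≤ 0.538) :
    ρ.re < 1 - 1 / (9.645908801 * L) := by
  by_contra hcon
  have hβw := not_lt.1 hcon
  obtain ⟨hL0, hσ, hσ', hβ, hγ', hβ', hinv⟩ :=
    setup hL10 (by norm_num : (0:ℝ) < 0.69) le_rfl le_rfl hβw hγ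
  set σ := 1 + 0.69 / L with hσdef
  have hpos := positivity_poly χ (one_add_re_nonneg χ) hσ
  simp only [zero_mul, add_zero, one_mul] at hpos
  have hζ := fdiff_principal_le_sharp13 (k := k) hσ hσ'
  have hs := sum_help_nonneg' k hσ
  have h10 := lemma10_real hχ h1 h2 hσ hσ' hz hβ hγ0 hγ'
  have hK := bigK_pos
  have hKL : bigK * Real.log k ≤ bigK * L := mul_le_mul_of_nonneg_left hLk hK.le
  have hmain : 2 * (σ - ρ.re) / ((σ - ρ.re) ^ 2 + ρ.im ^ 2) ≤ (1 / 0.69 + bigK) * L := by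
    have e : 2 * (σ - ρ.re) / ((σ - ρ.re) ^ 2 + ρ.im ^ 2) =
        2 * ((σ - ρ.re) / ((σ - ρ.re) ^ 2 + ρ.im ^ 2)) := by ring
    rw [e]
    rw [hinv] at hζ
    have h' : 2 * ((σ - ρ.re) / ((σ - ρ.re) ^ 2 + ρ.im ^ 2)) ≤ L / 0.69 + bigK * L := by linarith
    calc _ ≤ L / 0.69 + bigK * L := h'
      _ = (1 / 0.69 + bigK) * L := by ring
  have hβ1 : ρ.re < 1 := by
    by_contra h
    exact LFunction_ne_zero_of_one_le_re χ (Or.inl h1) (not_lt.1 h) hz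
  refine endgame_pair (A := 1 / 0.69 + bigK) (b₀ := 1 / 9.645908801) (c₀ := 0.538) hL0
    (by norm_num) (by norm_num) (by norm_num) hσdef hβ1 hβ' hγ hmain ?_
  have hK' := bigK_lt
  have : (1 : ℝ) / 0.69 + 0.276395 < 2 * (0.69 + 1 / 9.645908801) / ((0.69 + 1 / 9.645908801) ^ 2 + 0.538 ^ 2) := by
    norm_num
  linarith

/-- **McCurley's Theorem 1, §6 clause for quartic characters.** Let `χ` be a primitive character
mod `k` with `χ⁴ = χ₀`, `χ² ≠ χ₀`, `L ≥ log k`, `L ≥ log 10`, and `ρ = β + iγ` a zero of `L(s, χ)`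
with `|γ|·L ≤ 0.262`. Then `β < 1 − 1/(R L)` (inequality
`f(0,χ₀) + [f(0,χ)+f(0,χ̄)] + f(0,χ²) ≥ 0`, Lemmas 3, 9, 10, `σ = 1 + 0.62/L`:
`2(r+b)/((r+b)²+c²) < 1/r + 3K`). [cite: McCurley1984ZFR, §6 (order 4, (46)) and Theorem 1] -/
theorem order_four_small_height (hχ : χ.IsPrimitive) (h2 : χ ^ 2 ≠ 1) (h4 : χ ^ 4 = 1) {L : ℝ}
    (hLk : Real.log k ≤ L) (hL10 : Real.log 10 ≤ L) {ρ : ℂ} (hz : χ.LFunction ρ = 0)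
    (hγ : |ρ.im| * L ≤ 0.262) :
    ρ.re < 1 - 1 / (9.645908801 * L) := by
  by_contra hcon
  have hβw := not_lt.1 hcon
  have h1 : χ ≠ 1 := fun h ↦ h2 (by rw [h, one_pow])
  obtain ⟨hL0, hσ, hσ', hβ, hγ', hβ', hinv⟩ :=
    setup hL10 (by norm_num : (0:ℝ) < 0.62) (by norm_num) (by norm_num : (0.262:ℝ) ≤ 0.538) hβw hγ
  set σ := 1 + 0.62 / L with hσdef
  have hpos := positivity_poly χ (re_poly_nonneg_of_fourth_eq_one χ h4) hσ
  simp only [one_mul] at hpos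
  have hζ := fdiff_principal_le_sharp13 (k := k) hσ hσ'
  have hs := sum_help_nonneg' k hσ
  have h10 := lemma10_complex hχ h1 hσ hσ' hz hβ hγ'
  have h9 := fdiff_induced_le (χ ^ 2) h2 hσ hσ'
  have hG := sum_max_gPen_le k hσ
  have hK := bigK_pos
  have hKL : bigK * Real.log k ≤ bigK * L := mul_le_mul_of_nonneg_left hLk hK.le
  have hmain : 2 * (σ - ρ.re) / ((σ - ρ.re) ^ 2 + ρ.im ^ 2) ≤ (1 / 0.62 + 3 * bigK) * L := by
    have e : 2 * (σ - ρ.re) / ((σ - ρ.re) ^ 2 + ρ.im ^ 2) =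
        2 * ((σ - ρ.re) / ((σ - ρ.re) ^ 2 + ρ.im ^ 2)) := by ring
    rw [e]
    rw [hinv] at hζ
    have h' : 2 * ((σ - ρ.re) / ((σ - ρ.re) ^ 2 + ρ.im ^ 2)) ≤ L / 0.62 + 3 * (bigK * L) := by linarith
    calc _ ≤ L / 0.62 + 3 * (bigK * L) := h'
      _ = (1 / 0.62 + 3 * bigK) * L := by ring
  have hβ1 : ρ.re < 1 := by
    by_contra h
    exact LFunction_ne_zero_of_one_le_re χ (Or.inl h1) (not_lt.1 h) hz
  refine endgame_pair (A := 1 / 0.62 + 3 * bigK) (b₀ := 1 / 9.645908801) (c₀ := 0.262) hL0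
    (by norm_num) (by norm_num) (by norm_num) hσdef hβ1 hβ' hγ hmain ?_
  have hK' := bigK_lt
  have : (1 : ℝ) / 0.62 + 3 * 0.276395 < 2 * (0.62 + 1 / 9.645908801) / ((0.62 + 1 / 9.645908801) ^ 2 + 0.262 ^ 2) := by
    norm_num
  linarith

end Clauses

end McCurleyStechkin

end Literature.NumberTheory.LFunctions
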